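import Literature.AnabelianGeometry.AbsoluteAnabelian.AbsTopIII.CcnSynchronizationBijective
import HarnessLib

/-!
# [AbsTopIII] Prop. 1.4 (ii): the `∃`-shaped synchronization fact follows from the natural one

`GeometricCyclotome.lean` (the first gen-2 file on the intrinsic cyclotome) typed Prop. 1.4 (ii),
second half, as `CurveModel.Prop_1_4_ii_sync`: the EXISTENCE of a `Π_{U_x}`-equivariant isomorphism
between `M_X = Hom(H²(Δ_X, Ẑ), Ẑ)` and the extrinsic cyclotome `geomCyclotome (M.res h)` (the copy of
`I_x` inside `Π_{U_x}/[N, Δ]⁻`).  The later files construct the NATURAL synchronization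
(`synchronizationOfBijective`, `CcnTransgression.lean`), prove its `Π_{U_x}`-equivariance and — given
bijectivity of the differential and `I_x ≅ Ẑ` — its bijectivity (`CcnSynchronization(Bijective).lean`).
This file closes the loop, all PROVED:

* `synchronizationOfBijective_conj` — equivariance of the natural synchronization of the kernel under
  ALL of `Π_{U_x}` (conjugation on the kernel of `Δ^{c-cn}_{U_x} ↠ Δ_X`, `H²(c_g)` on `M_X`);
* `extKerEquivGeomCyclotome` — the kernel IS `geomCyclotome q`;
* `inertiaSynchronizationVia` (+ `_conj`) — the synchronization `I_z → M_Z` through an intermediate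
  cuspidal quotient `Π_U → Π_{U_z} → Π_Z` (Thm. 1.9 (b) for several cusps, "via the technique of
  Proposition 1.4, (ii)"), with its equivariance (PROVED);
* `CurveModel.prop_1_4_ii_sync_of` — **`Prop_1_4_i' → Prop_1_4_ii_transgression → (∀ cyclotome
  presentation, I_x ≃ₜ+ Ẑ) → Prop_1_4_ii_sync`**: the `∃`-fact is DERIVED from the natural-map fact;
* `CurveModel.inertiaSyncEquiv` (+ `_decomp`) — the packaged natural synchronization `I_x ≃+ M_X` for a
  cyclotome presentation (consumer endpoint).

Mochizuki, *Topics in Absolute Anabelian Geometry III*, Prop. 1.4 (ii) pp. 31–32 (lit key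
`paper:url-5493eb38cbb7`).  HONEST FRAMING: nothing here bears on [IUTchIII] Cor. 3.12.
-/

noncomputable section

open CategoryTheory

universe u

namespace Literature.AnabelianGeometry.AbsoluteAnabelian.AbsTopIII

variable {E F : FundamentalExtension.{u}} (q : E ⟶ F)

/-- **Equivariance of the natural synchronization of the kernel under `Π_{U_x}`**:
`sync(ḡ a ḡ⁻¹) = g · sync(a)`. [cite: MochizukiAbsTopIII2015, Prop 1.4 (ii) p.32] -/
theorem synchronizationOfBijective_conj (s : CcnSection q)
    (hd : Function.Bijective (ccnTransgression q ZHatCoeff.{u} s)) (g : E.arith)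
    (a : Additive (ContinuousCohomology.extKer (deltaCcnProjₜ q))) :
    synchronizationOfBijective q s hd (extKerConj q g a) =
      geomCyclotomeDualMap F ZHatCoeff.{u} (q.arith g) (synchronizationOfBijective q s hd a) := by
  apply LinearMap.ext
  intro ξ
  rw [geomCyclotomeDualMap_apply, synchronizationOfBijective_apply, synchronizationOfBijective_apply]
  have key : (AddEquiv.ofBijective _ hd).symm ((geomH2Map F ZHatCoeff.{u} (q.arith g)).hom ξ) =
      ((AddEquiv.ofBijective _ hd).symm ξ).comp (extKerConj q g) := by
    apply (AddEquiv.ofBijective _ hd).injective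
    rw [AddEquiv.apply_symm_apply]
    change _ = ccnTransgression q ZHatCoeff.{u} s
      (((AddEquiv.ofBijective _ hd).symm ξ).comp (extKerConj q g))
    rw [← geomH2Map_ccnTransgression]
    change (geomH2Map F ZHatCoeff.{u} (q.arith g)).hom ξ = (geomH2Map F ZHatCoeff.{u} (q.arith g)).hom
      ((AddEquiv.ofBijective _ hd) ((AddEquiv.ofBijective _ hd).symm ξ))
    rw [AddEquiv.apply_symm_apply]
  rw [key]
  rfl

/-- The kernel of `Δ^{c-cn}_{U_x} ↠ Δ_X` IS the extrinsic cyclotome `geomCyclotome q`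
(`ker_deltaCcnProj` repackaged as a multiplicative isomorphism).
[cite: MochizukiAbsTopIII2015, Prop 1.4 (ii) p.31] -/
def extKerEquivGeomCyclotome : ContinuousCohomology.extKer (deltaCcnProjₜ q) ≃* geomCyclotome q where
  toFun y := ⟨((y : DeltaCcn q) : CuspidallyCentralQuotient q), by
    have hy : (y : DeltaCcn q) ∈ (geomCyclotome q).subgroupOf (DeltaCcn q) := by
      rw [← extKer_deltaCcnProjₜ]
      exact y.2
    exact Subgroup.mem_subgroupOf.mp hy⟩
  invFun c := ⟨⟨(c : CuspidallyCentralQuotient q), geomCyclotome_le_DeltaCcn q c.2⟩, by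
    rw [extKer_deltaCcnProjₜ, Subgroup.mem_subgroupOf]
    exact c.2⟩
  left_inv y := Subtype.ext (Subtype.ext rfl)
  right_inv c := Subtype.ext rfl
  map_mul' y z := Subtype.ext rfl

/-- Value of `extKerEquivGeomCyclotome`. [cite: MochizukiAbsTopIII2015, Prop 1.4 (ii) p.31] -/
@[simp] theorem coe_extKerEquivGeomCyclotome (y : ContinuousCohomology.extKer (deltaCcnProjₜ q)) :
    ((extKerEquivGeomCyclotome q y : geomCyclotome q) : CuspidallyCentralQuotient q) =
      ((y : DeltaCcn q) : CuspidallyCentralQuotient q) :=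
  rfl

/-! ### The synchronization through an intermediate cuspidal quotient (`U ⊆ U_z ⊆ Z`) -/

section Via

variable {E₁ : FundamentalExtension.{u}} (q₁ : E₁ ⟶ E) {I : Subgroup E₁.arith}

/-- For a chain of cuspidal quotients `Π_U → Π_{U_z} → Π_Z` (`q₁`, `q`) and an inertia group
`I_z ⊆ Π_U` whose image in `Π_{U_z}` lies in the cuspidal kernel `N` of `q` (Prop. 1.4 (i): the
inertia group of the cusp `z` of `U` maps onto that of `z` in `U_z = Z ∖ {z}`), **the synchronization
`I_z → M_Z` "via the technique of Proposition 1.4, (ii)"** (Thm. 1.9 (b) p. 37, several cusps): the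
synchronization of `q` precomposed with `q₁|_{I_z}`. [cite: MochizukiAbsTopIII2015, Thm 1.9 (b) p.37] -/
def inertiaSynchronizationVia (hI : I.map q₁.arith.toMonoidHom ≤ cuspidalKernel q) (s : CcnSection q)
    (hd : Function.Bijective (ccnTransgression q ZHatCoeff.{u} s)) :
    Additive I →+ geomCyclotomeDual F ZHatCoeff.{u} :=
  (inertiaSynchronization q hI s hd).comp
    (MonoidHom.toAdditive (q₁.arith.toMonoidHom.subgroupMap I))

/-- Formula. [cite: MochizukiAbsTopIII2015, Thm 1.9 (b) p.37] -/
theorem inertiaSynchronizationVia_apply (hI : I.map q₁.arith.toMonoidHom ≤ cuspidalKernel q)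
    (s : CcnSection q) (hd : Function.Bijective (ccnTransgression q ZHatCoeff.{u} s)) (i : I) :
    inertiaSynchronizationVia q q₁ hI s hd (Additive.ofMul i) =
      inertiaSynchronization q hI s hd (Additive.ofMul (q₁.arith.toMonoidHom.subgroupMap I i)) :=
  rfl

/-- **Equivariance through the chain**: for `g ∈ Π_U` normalizing `I_z` (e.g. `g ∈ D_z`),
`syncVia(g i g⁻¹) = (q (q₁ g)) · syncVia(i)`.  PROVED. [cite: MochizukiAbsTopIII2015, Thm 1.9 (b) p.37] -/
theorem inertiaSynchronizationVia_conj (hI : I.map q₁.arith.toMonoidHom ≤ cuspidalKernel q)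
    (s : CcnSection q) (hd : Function.Bijective (ccnTransgression q ZHatCoeff.{u} s)) (g : E₁.arith)
    (i : I) (hgi : g * i * g⁻¹ ∈ I) :
    inertiaSynchronizationVia q q₁ hI s hd (Additive.ofMul ⟨g * i * g⁻¹, hgi⟩) =
      geomCyclotomeDualMap F ZHatCoeff.{u} (q.arith (q₁.arith g))
        (inertiaSynchronizationVia q q₁ hI s hd (Additive.ofMul i)) := by
  rw [inertiaSynchronizationVia_apply, inertiaSynchronizationVia_apply]
  have hgi' : q₁.arith g * (q₁.arith.toMonoidHom.subgroupMap I i : E.arith) * (q₁.arith g)⁻¹ ∈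
      I.map q₁.arith.toMonoidHom := by
    refine Subgroup.mem_map.mpr ⟨g * i * g⁻¹, hgi, ?_⟩
    change q₁.arith (g * i * g⁻¹) = _
    rw [map_mul, map_mul, map_inv]
    rfl
  have key := inertiaSynchronization_conj hI s hd (q₁.arith g)
    (q₁.arith.toMonoidHom.subgroupMap I i) hgi'
  rw [← key]
  congr 2
  apply Subtype.ext
  change q₁.arith (g * i * g⁻¹) = q₁.arith g * q₁.arith (i : E₁.arith) * (q₁.arith g)⁻¹
  rw [map_mul, map_mul, map_inv]

end Via

namespace CurveModel

variable (M : CurveModel.{u})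

/-- **`Prop_1_4_ii_sync` DERIVED**: given Prop. 1.4 (i) (surjectivity of the cuspidal quotients, for
the existence of sections), the natural form of Prop. 1.4 (ii) (`Prop_1_4_ii_transgression`: the
differential is bijective) and "`I_x ≅ Ẑ`" for every cyclotome presentation, the `∃`-shaped fact
`Prop_1_4_ii_sync` holds — witnessed by THE natural synchronization.  PROVED.
[cite: MochizukiAbsTopIII2015, Prop 1.4 (ii) p.32] -/
theorem prop_1_4_ii_sync_of (h14 : M.Prop_1_4_i') (hT : M.Prop_1_4_ii_transgression)
    (he : ∀ (Ux X : M.Curve) (h : M.IsCofiniteOpen Ux X) (x : (M.cusps Ux).Cusp),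
      M.IsCyclotomePresentation h x → Nonempty (Additive ((M.cusps Ux).Icusp x) ≃ₜ+ ZHatCoeff.{u})) :
    M.Prop_1_4_ii_sync := by
  intro Ux X h x hp
  obtain ⟨s⟩ := M.nonempty_ccnSection_res h14 h hp.isScheme.1 hp.isScheme.2
  have hd := hT Ux X h x hp s
  obtain ⟨e₀⟩ := he Ux X h x hp
  let e := kerEquivZHatOfInertia hp.isCuspidallyCentral ((M.cusps Ux).isClosed_Icusp x) e₀
  have hbij := synchronizationOfBijective_bijective (M.res h) s hd e
  let ψ : Additive (ContinuousCohomology.extKer (deltaCcnProjₜ (M.res h))) ≃+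
      geomCyclotomeDual (M.ext X) ZHatCoeff.{u} := AddEquiv.ofBijective _ hbij
  let κ : Additive (ContinuousCohomology.extKer (deltaCcnProjₜ (M.res h))) ≃+
      Additive (geomCyclotome (M.res h)) := MulEquiv.toAdditive (extKerEquivGeomCyclotome (M.res h))
  refine ⟨ψ.symm.trans κ, fun g m => ?_⟩
  -- write `m = ψ a`
  obtain ⟨a, rfl⟩ : ∃ a, ψ a = m := ⟨ψ.symm m, ψ.apply_symm_apply m⟩
  have hconj : ψ (extKerConj (M.res h) g a) =
      M.cyclotomeActionOfOpen h ZHatCoeff.{u} g (ψ a) :=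
    synchronizationOfBijective_conj (M.res h) s hd g a
  rw [← hconj, AddEquiv.trans_apply, AddEquiv.trans_apply, AddEquiv.symm_apply_apply,
    AddEquiv.symm_apply_apply]
  apply Subtype.ext
  rw [MulAut.conjNormal_apply]
  rfl

/-- **The natural synchronization `I_x ≃ M_X` as an additive isomorphism**, for a cyclotome
presentation of a model satisfying Prop. 1.4 (i) (`Prop_1_4_i'`, for the section), the natural form
of Prop. 1.4 (ii) (`Prop_1_4_ii_transgression`) and with `I_x ≅ Ẑ`: packaged consumer endpoint
(the underlying map is `inertiaSynchronization`, independent of the chosen section by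
`inertiaSynchronization_eq`). [cite: MochizukiAbsTopIII2015, Thm 1.9 (b) p.37] -/
def inertiaSyncEquiv (h14 : M.Prop_1_4_i') (hT : M.Prop_1_4_ii_transgression)
    {Ux X : M.Curve} (h : M.IsCofiniteOpen Ux X) (x : (M.cusps Ux).Cusp)
    (hp : M.IsCyclotomePresentation h x) (e₀ : Additive ((M.cusps Ux).Icusp x) ≃ₜ+ ZHatCoeff.{u}) :
    Additive ((M.cusps Ux).Icusp x) ≃+ geomCyclotomeDual (M.ext X) ZHatCoeff.{u} :=
  let s : CcnSection (M.res h) := (M.nonempty_ccnSection_res h14 h hp.isScheme.1 hp.isScheme.2).some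
  AddEquiv.ofBijective
    (inertiaSynchronization (M.res h) hp.isCuspidallyCentral.le_cuspidalKernel s (hT Ux X h x hp s))
    (inertiaSynchronization_bijective hp.isCuspidallyCentral s (hT Ux X h x hp s)
      (kerEquivZHatOfInertia hp.isCuspidallyCentral ((M.cusps Ux).isClosed_Icusp x) e₀))

/-- The packaged synchronization IS `inertiaSynchronization` (for the chosen section).
[cite: MochizukiAbsTopIII2015, Thm 1.9 (b) p.37] -/
theorem inertiaSyncEquiv_apply (h14 : M.Prop_1_4_i') (hT : M.Prop_1_4_ii_transgression)
    {Ux X : M.Curve} (h : M.IsCofiniteOpen Ux X) (x : (M.cusps Ux).Cusp)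
    (hp : M.IsCyclotomePresentation h x) (e₀ : Additive ((M.cusps Ux).Icusp x) ≃ₜ+ ZHatCoeff.{u})
    (i : Additive ((M.cusps Ux).Icusp x)) :
    M.inertiaSyncEquiv h14 hT h x hp e₀ i =
      inertiaSynchronization (M.res h) hp.isCuspidallyCentral.le_cuspidalKernel
        (M.nonempty_ccnSection_res h14 h hp.isScheme.1 hp.isScheme.2).some
        (hT Ux X h x hp _) i :=
  rfl

/-- **`D_x`-equivariance of the packaged synchronization**: `sync(d i d⁻¹) = d · sync(i)` for `d ∈ D_x`.
[cite: MochizukiAbsTopIII2015, Thm 1.9 (b) p.37] -/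
theorem inertiaSyncEquiv_decomp (h14 : M.Prop_1_4_i') (hT : M.Prop_1_4_ii_transgression)
    {Ux X : M.Curve} (h : M.IsCofiniteOpen Ux X) (x : (M.cusps Ux).Cusp)
    (hp : M.IsCyclotomePresentation h x) (e₀ : Additive ((M.cusps Ux).Icusp x) ≃ₜ+ ZHatCoeff.{u})
    {d : (M.ext Ux).arith} (hdx : d ∈ (M.cusps Ux).Dcusp x) (i : (M.cusps Ux).Icusp x) :
    M.inertiaSyncEquiv h14 hT h x hp e₀
        (Additive.ofMul ⟨d * i * d⁻¹, (M.cusps Ux).conj_mem_Icusp x hdx i.2⟩) =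
      geomCyclotomeDualMap (M.ext X) ZHatCoeff.{u} ((M.res h).arith d)
        (M.inertiaSyncEquiv h14 hT h x hp e₀ (Additive.ofMul i)) :=
  M.inertiaSynchronization_decomp h x _ _ _ hdx i

end CurveModel

end Literature.AnabelianGeometry.AbsoluteAnabelian.AbsTopIII
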